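import Mathlib
import Summits.ValiantsHypothesis.ValiantsHypothesis.Theorems.NewtonUnitEquationsDissociatedUniformTotalsLawConeCount
import HarnessLib

/-!
# Crux `NewtonUnitEquations.DissociatedUniform` (stmt-ValiantsHypothesis-5905): the cone sweep count for GENERAL fibres — at most two
# weak tops per weight suffice, edges become exposed PAIRS of labels

Memo `Cruxes/DissociatedUniform/NOTES-t1g8.md` §2 / NOTES-d1g3 §2 L5.  `…TotalsLawConeCount.card_commonTop_le` needs SHARP tops of the fibre
(two weak tops are label-adjacent), which only strictly convex fibres have (rigid pairs).  The fibres `x ↦ a x + b (r − x)` of a general pair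
are not convex polygons, but in general position they still have AT MOST TWO weak tops per non-zero weight (`TwoTops`).  This file re-runs
the sweep of the normal cone of a vertex `z` of a strictly convex ccw polygon `c` with that weaker hypothesis, charging every top that
enters the cone after time `0` to the ORDERED PAIR (itself, the top it enters with):

* **`two_mul_card_commonTop_le`**: `2·#{x : ∃θ≠0, WTop c θ z ∧ WTop P θ x} ≤ 2 + #{(x, y) : x ≠ y, ∃θ≠0, WTop c θ z ∧ WTop P θ x ∧ WTop P θ y}`
  (both orientations of each entering pair are exposed pairs, they never collide — two tops cannot enter through each other — and the pair
  present at time `0`, if any, is two more).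
Consumers: the dominant-regime totals law for general pairs (`…TotalsLawTwoTopsTotals`).
Honest label: a counting lemma; `TotalsLawThree`, `SmoothSharpTotalsLaw` remain OPEN; nothing here bears on VP ≠ VNP.
[folklore]
-/

set_option linter.dupNamespace false -- `ValiantsHypothesis.ValiantsHypothesis` (summit = problem) in every name

open scoped BigOperators

namespace Summit.ValiantsHypothesis.ValiantsHypothesis.Theorems.NewtonUnitEquationsDissociatedUniform

namespace TotalsLaw

open Matrix Set

section TwoTopsCount

variable {q : ℕ} [NeZero q]

/-- AT MOST TWO WEAK TOPS per non-zero weight (no three labels on a supporting line; points may be non-convexly labelled). -/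
def TwoTops (P : ZMod q → (Fin 2 → ℝ)) : Prop :=
  ∀ θ : Fin 2 → ℝ, θ ≠ 0 → ∀ x y w : ZMod q, WTop P θ x → WTop P θ y → WTop P θ w → x = y ∨ y = w ∨ x = w

omit [NeZero q] in
/-- Sharp tops are in particular at most two. [folklore] -/
theorem SharpTops.twoTops {P : ZMod q → (Fin 2 → ℝ)} (h : SharpTops P) : TwoTops P := fun θ hθ => (h θ hθ).2

open scoped Classical in
/-- **THE CONE SWEEP COUNT FOR GENERAL FIBRES.**  For a strictly convex ccw polygon `c` (`q ≥ 3`), a vertex `z`, and any curve `P` with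
at most two weak tops per weight: twice the number of labels of `P` sharing a weak-top weight with `c z` is at most `2` plus the number of
ORDERED exposed pairs `(x, y)`, `x ≠ y`, sharing a weak-top weight with `c z`. [folklore] -/
theorem two_mul_card_commonTop_le {c : ZMod q → (Fin 2 → ℝ)} (hc : StrictlyConvexCcw c) (hq : 3 ≤ q)
    {P : ZMod q → (Fin 2 → ℝ)} (hP : TwoTops P) (z : ZMod q) :
    2 * (Finset.univ.filter fun x : ZMod q => ∃ θ : Fin 2 → ℝ, θ ≠ 0 ∧ WTop c θ z ∧ WTop P θ x).card ≤
      2 + (Finset.univ.filter fun xy : ZMod q × ZMod q =>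
        xy.1 ≠ xy.2 ∧ ∃ θ : Fin 2 → ℝ, θ ≠ 0 ∧ WTop c θ z ∧ WTop P θ xy.1 ∧ WTop P θ xy.2).card := by
  -- the sweep data
  set θp := conePath c z with hθp
  set T : ZMod q → Set ℝ := fun x => {t : ℝ | WTop P (θp t) x} with hT
  have hTc : ∀ x, IsClosed (T x) := fun x => isClosed_wTop_conePath c z P x
  have hcov : ∀ s ∈ Icc (0 : ℝ) 1, ∃ x, s ∈ T x := fun s _ => exists_wTop P (θp s)
  have hne : ∀ s, θp s ≠ 0 := fun s => conePath_ne_zero hc hq z s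
  have h2 : ∀ s ∈ Icc (0 : ℝ) 1, ∀ x y w : ZMod q, s ∈ T x → s ∈ T y → s ∈ T w → x = y ∨ y = w ∨ x = w :=
    fun s _ x y w hx hy hw => hP (θp s) (hne s) x y w hx hy hw
  set S := Finset.univ.filter fun x : ZMod q => ∃ θ : Fin 2 → ℝ, θ ≠ 0 ∧ WTop c θ z ∧ WTop P θ x with hS
  set OE := Finset.univ.filter fun xy : ZMod q × ZMod q =>
    xy.1 ≠ xy.2 ∧ ∃ θ : Fin 2 → ℝ, θ ≠ 0 ∧ WTop c θ z ∧ WTop P θ xy.1 ∧ WTop P θ xy.2 with hOE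
  have hmemS : ∀ x, x ∈ S ↔ ∃ t ∈ Icc (0 : ℝ) 1, t ∈ T x := fun x => by
    rw [hS, Finset.mem_filter, commonTop_iff_conePath hc hq z P x]
    simp only [Finset.mem_univ, true_and, hT, hθp, Set.mem_setOf_eq]
  have hmemOE : ∀ x y, x ≠ y → ∀ t ∈ Icc (0 : ℝ) 1, t ∈ T x → t ∈ T y → (x, y) ∈ OE := fun x y hxy t ht h1 h2' => by
    rw [hOE, Finset.mem_filter]
    exact ⟨Finset.mem_univ _, hxy, θp t, hne t, wTop_conePath hc hq z ht, h1, h2'⟩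
  have h0I : (0 : ℝ) ∈ Icc (0 : ℝ) 1 := ⟨le_rfl, zero_le_one⟩
  set S₀ := S.filter fun x => (0 : ℝ) ∈ T x with hS₀
  set S' := S.filter fun x => (0 : ℝ) ∉ T x with hS'
  have hcardS : S₀.card + S'.card = S.card := Finset.card_filter_add_card_filter_not _
  -- entries: each later top enters together with another top
  have hentry : ∀ x, x ∈ S' → ∃ t y, (t ∈ Icc (0 : ℝ) 1 ∧ 0 < t ∧ (∀ s ∈ Icc (0 : ℝ) 1, s ∈ T x → t ≤ s)) ∧
      y ≠ x ∧ t ∈ T x ∧ t ∈ T y := by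
    intro x hx
    obtain ⟨hxS, hx0⟩ := Finset.mem_filter.1 hx
    obtain ⟨t₀, ht₀, hxt₀⟩ := (hmemS x).1 hxS
    obtain ⟨t, ht, htx, htpos, hmin, y, hyx, hty⟩ := exists_min_mem_other T hTc hcov ht₀ hxt₀ hx0
    exact ⟨t, y, ⟨ht, htpos, hmin⟩, hyx, htx, hty⟩
  choose! tt yy hent using hentry
  -- the two families of ordered pairs
  set A := S'.image fun x => (x, yy x) with hA
  set B := S'.image fun x => (yy x, x) with hB
  have hAOE : A ⊆ OE := by
    intro p hp
    obtain ⟨x, hx, rfl⟩ := Finset.mem_image.1 hp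
    obtain ⟨⟨ht, -, -⟩, hyx, htx, hty⟩ := hent x hx
    exact hmemOE _ _ hyx.symm _ ht htx hty
  have hBOE : B ⊆ OE := by
    intro p hp
    obtain ⟨x, hx, rfl⟩ := Finset.mem_image.1 hp
    obtain ⟨⟨ht, -, -⟩, hyx, htx, hty⟩ := hent x hx
    exact hmemOE _ _ hyx _ ht hty htx
  have hcardA : A.card = S'.card := Finset.card_image_of_injOn fun x _ x' _ h => (Prod.mk.inj h).1
  have hcardB : B.card = S'.card := Finset.card_image_of_injOn fun x _ x' _ h => (Prod.mk.inj h).2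
  have hdisj : Disjoint A B := by
    rw [Finset.disjoint_left]
    intro p hpA hpB
    obtain ⟨x, hx, rfl⟩ := Finset.mem_image.1 hpA
    obtain ⟨x', hx', hxx⟩ := Finset.mem_image.1 hpB
    obtain ⟨e1, e2⟩ := Prod.mk.inj hxx
    -- `yy x' = x` and `x' = yy x`: the two tops would enter through each other
    obtain ⟨⟨ht, htpos, hmin⟩, hyx, htx, hty⟩ := hent x hx
    obtain ⟨⟨ht', -, hmin'⟩, hyx', htx', hty'⟩ := hent x' hx'
    by_cases hxe : x = x'
    · subst hxe; exact hyx e1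
    · refine not_mutual_min T hTc hcov h2 hxe ht htpos hmin ht' hmin' ?_ ?_
      · rw [e2]; exact hty
      · rw [← e1]; exact hty'
  have hcardAB : (A ∪ B).card = 2 * S'.card := by
    rw [Finset.card_union_of_disjoint hdisj, hcardA, hcardB]; ring
  have hABOE : A ∪ B ⊆ OE := Finset.union_subset hAOE hBOE
  -- the start: at most two tops, and if two then two more exposed pairs outside `A ∪ B`
  by_cases h1 : S₀.card ≤ 1
  · have := Finset.card_le_card hABOE
    omega
  · obtain ⟨u, hu, v, hv, huv⟩ := Finset.one_lt_card.1 (show 1 < S₀.card by omega)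
    have hu0 : (0 : ℝ) ∈ T u := (Finset.mem_filter.1 hu).2
    have hv0 : (0 : ℝ) ∈ T v := (Finset.mem_filter.1 hv).2
    have hS₀2 : S₀.card ≤ 2 := by
      by_contra h3
      obtain ⟨u', hu', v', hv', w', hw', huv', huw', hvw'⟩ := Finset.two_lt_card.1 (show 2 < S₀.card by omega)
      rcases h2 0 h0I u' v' w' (Finset.mem_filter.1 hu').2 (Finset.mem_filter.1 hv').2 (Finset.mem_filter.1 hw').2 with h | h | h
      · exact huv' h
      · exact hvw' h
      · exact huw' h
    have huS' : u ∉ S' := fun h => (Finset.mem_filter.1 h).2 hu0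
    have hvS' : v ∉ S' := fun h => (Finset.mem_filter.1 h).2 hv0
    have hnotAB : ∀ p : ZMod q × ZMod q, p.1 ∉ S' → p.2 ∉ S' → p ∉ A ∪ B := by
      intro p hp1 hp2 hp
      rcases Finset.mem_union.1 hp with h | h
      · obtain ⟨x, hx, rfl⟩ := Finset.mem_image.1 h; exact hp1 hx
      · obtain ⟨x, hx, rfl⟩ := Finset.mem_image.1 h; exact hp2 hx
    have huvOE : (u, v) ∈ OE := hmemOE u v huv 0 h0I hu0 hv0
    have hvuOE : (v, u) ∈ OE := hmemOE v u (Ne.symm huv) 0 h0I hv0 hu0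
    have hne' : (u, v) ≠ (v, u) := fun h => huv (Prod.mk.inj h).1
    set E := insert (u, v) (insert (v, u) (A ∪ B)) with hE
    have hEOE : E ⊆ OE := by
      rw [hE]
      exact Finset.insert_subset huvOE (Finset.insert_subset hvuOE hABOE)
    have hcardE : E.card = 2 * S'.card + 2 := by
      rw [hE, Finset.card_insert_of_notMem, Finset.card_insert_of_notMem (hnotAB _ hvS' huS'), hcardAB]
      rw [Finset.mem_insert, not_or]
      exact ⟨hne', hnotAB _ huS' hvS'⟩
    have := Finset.card_le_card hEOE
    omega

end TwoTopsCount

end TotalsLaw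

end Summit.ValiantsHypothesis.ValiantsHypothesis.Theorems.NewtonUnitEquationsDissociatedUniform
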